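import Mathlib
import Summits.Ventures.PercRepro.TriangleCapSubBandMember
import Summits.Ventures.PercRepro.TriangleCapSubBandTop

/-!
# PercRepro — THE DEEP WITNESS FAMILY ON `4 + (s − t)` VERTICES: LEFT DEGREES `(D, c₂, c₃)`, FULL AND PAIR ROWS
(p3, gen 54; part 282)

The pair witness with three non-neighbours `1, 2, 3` of `w = 0`, every off-pair ending at a leaf of the star:
`lf3 D c₂` sends `D` pairs to `1`, `c₂` to `2`, `c₃ = t − D − c₂` to `3`; `rf3 D c₂ α β` lets the first `α` pairs
of each block share a leaf (FULL rows `{1, 2, 3}`), the next `β` pairs of the blocks `1, 2` share a leaf (PAIR rows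
`{1, 2}`), and gives every other pair a fresh leaf.  Collision counts: `coll t lf3 = D(D−1) + c₂(c₂−1) + c₃(c₃−1)`
(`coll_lf3`, by the concatenation lemma), `coll t rf3 = 6 α + 2 β` (`coll_rf3`, by the class sum: a full row has
three pairs, a pair row two, a fresh leaf one).  THE WITNESS (`deepThreeWitness`, `3 ≤ D`, `c₃ ≤ c₂ ≤ D`,
`α ≤ c₃`, `α + β ≤ c₂`, `2 t ≤ s`): a triangle-free graph on `4 + (s − t)` vertices with `s` edges, a vertex `w` of
degree `s − t`, every off-degree `≤ D`, a non-neighbour of off-degree `D`, and the band value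
`2 j = t(t − 1) − (D(D−1) + c₂(c₂−1) + c₃(c₃−1) + 6 α + 2 β)`.  The off-degree of every vertex of a pair witness:
a left vertex `v < a` carries `#{i : lf i = v}`, a right vertex `a ≤ v` carries `#{i : rf i = v}`
(`offDeg_genWitness_left`, `offDeg_genWitness_right`).  Axioms: standard.
-/

namespace PercRepro

namespace TriangleCap

namespace C047

open Finset

/-- The off-degree of a left vertex `v < a` in a pair witness: the pairs with left end `v`. -/
theorem offDeg_genWitness_left (n a r t : ℕ) (hn : 0 < n) (lf rf : ℕ → ℕ) (hg : GoodEnds n a t lf rf)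
    (han : a ≤ n) (v : ℕ) (hv : v < a) :
    offDeg (missingGraph (genWitness n a r t hn lf rf) (leftPart n a)) (fin' n hn 0) (fin' n hn v) =
      ((range t).filter (fun i => lf i = v)).card := by
  unfold offDeg
  rw [offEdges_missingGraph_genWitness n a r t hn lf rf hg han]
  unfold genPairs
  rw [card_filter_image_of_injOn (fun i hi i' hi' h => by
    rw [mem_coe, mem_range] at hi hi'
    exact (genPair_eq_iff n a t hn lf rf hg i i' hi hi' han).mp h)]
  apply congrArg
  apply filter_congr
  intro i hi
  rw [mem_range] at hi
  rw [mem_genPair_iff n a t hn lf rf hg i hi han, fin'_val n hn v (by omega)]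
  have := hg.2.1 i hi
  constructor
  · rintro (h | h)
    · exact h.symm
    · omega
  · intro h
    exact Or.inl h.symm

/-- The off-degree of a right vertex `a ≤ v < n` in a pair witness: the pairs with right end `v`. -/
theorem offDeg_genWitness_right (n a r t : ℕ) (hn : 0 < n) (lf rf : ℕ → ℕ) (hg : GoodEnds n a t lf rf)
    (han : a ≤ n) (v : ℕ) (hva : a ≤ v) (hvn : v < n) :
    offDeg (missingGraph (genWitness n a r t hn lf rf) (leftPart n a)) (fin' n hn 0) (fin' n hn v) =
      ((range t).filter (fun i => rf i = v)).card := by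
  unfold offDeg
  rw [offEdges_missingGraph_genWitness n a r t hn lf rf hg han]
  unfold genPairs
  rw [card_filter_image_of_injOn (fun i hi i' hi' h => by
    rw [mem_coe, mem_range] at hi hi'
    exact (genPair_eq_iff n a t hn lf rf hg i i' hi hi' han).mp h)]
  apply congrArg
  apply filter_congr
  intro i hi
  rw [mem_range] at hi
  rw [mem_genPair_iff n a t hn lf rf hg i hi han, fin'_val n hn v hvn]
  have := hg.1 i hi
  constructor
  · rintro (h | h)
    · omega
    · exact h.symm
  · intro h
    exact Or.inr h.symm

/-- The collision count of a constant function on `range m` is `m (m − 1)`. -/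
theorem coll_const (m c : ℕ) : coll m (fun _ => c) = m * (m - 1) := by
  unfold coll
  rw [filter_true_of_mem (fun _ _ => rfl), offDiag_card, card_range, Nat.mul_sub_one]

/-- The left ends: `D` pairs at `1`, then `c₂` at `2`, the rest at `3`. -/
def lf3 (D c₂ i : ℕ) : ℕ := if i < D then 1 else if i < D + c₂ then 2 else 3

/-- The right ends: in each block the position `p < α` shares the leaf `4 + p` (a full row), in the blocks `1, 2`
the positions `α ≤ p < α + β` share the leaf `4 + p` (a pair row), every other pair gets a fresh leaf. -/
def rf3 (D c₂ α β i : ℕ) : ℕ :=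
  if i < D then 4 + i
  else if i < D + c₂ then (if i - D < α + β then 4 + (i - D) else 4 + i - α - β)
  else (if i - D - c₂ < α then 4 + (i - D - c₂) else 4 + i - 2 * α - β)

/-- The regions of `rf3`. -/
theorem rf3_cases (D c₂ α β i : ℕ) :
    (i < D ∧ rf3 D c₂ α β i = 4 + i) ∨
    (D ≤ i ∧ i < D + c₂ ∧ i - D < α + β ∧ rf3 D c₂ α β i = 4 + (i - D)) ∨
    (D ≤ i ∧ i < D + c₂ ∧ α + β ≤ i - D ∧ rf3 D c₂ α β i = 4 + i - α - β) ∨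
    (D + c₂ ≤ i ∧ i - D - c₂ < α ∧ rf3 D c₂ α β i = 4 + (i - D - c₂)) ∨
    (D + c₂ ≤ i ∧ α ≤ i - D - c₂ ∧ rf3 D c₂ α β i = 4 + i - 2 * α - β) := by
  unfold rf3
  split_ifs with h1 h2 h3 h4
  · exact Or.inl ⟨h1, rfl⟩
  · exact Or.inr (Or.inl ⟨by omega, h2, h3, rfl⟩)
  · exact Or.inr (Or.inr (Or.inl ⟨by omega, h2, by omega, rfl⟩))
  · exact Or.inr (Or.inr (Or.inr (Or.inl ⟨by omega, h4, rfl⟩)))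
  · exact Or.inr (Or.inr (Or.inr (Or.inr ⟨by omega, by omega, rfl⟩)))

/-- The bounds of `lf3`. -/
theorem lf3_bounds (D c₂ i : ℕ) : 1 ≤ lf3 D c₂ i ∧ lf3 D c₂ i ≤ 3 := by
  unfold lf3
  split_ifs <;> omega

/-- The bounds of `rf3`: `4 ≤ rf3 i < 4 + t` for `i < t = D + c₂ + c₃`, `α + β ≤ c₂`, `α ≤ c₃`. -/
theorem rf3_bounds (D c₂ c₃ α β i : ℕ) (hαβ : α + β ≤ c₂) (hα : α ≤ c₃) (hi : i < D + c₂ + c₃) :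
    4 ≤ rf3 D c₂ α β i ∧ rf3 D c₂ α β i < 4 + (D + c₂ + c₃) := by
  rcases rf3_cases D c₂ α β i with ⟨h1, hv⟩ | ⟨h1, h2, h3, hv⟩ | ⟨h1, h2, h3, hv⟩ | ⟨h1, h2, hv⟩ | ⟨h1, h2, hv⟩ <;>
    rw [hv] <;> omega

/-- Within a block `rf3` is injective; two indices with the same right end and the same left end coincide. -/
theorem rf3_inj (D c₂ c₃ α β i i' : ℕ) (hc2 : c₂ ≤ D) (hαβ : α + β ≤ c₂) (_hα : α ≤ c₃) (_hi : i < D + c₂ + c₃)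
    (_hi' : i' < D + c₂ + c₃) (hl : lf3 D c₂ i = lf3 D c₂ i') (hr : rf3 D c₂ α β i = rf3 D c₂ α β i') :
    i = i' := by
  unfold lf3 at hl
  rcases rf3_cases D c₂ α β i with ⟨h1, hv⟩ | ⟨h1, h2, h3, hv⟩ | ⟨h1, h2, h3, hv⟩ | ⟨h1, h2, hv⟩ | ⟨h1, h2, hv⟩ <;>
    rcases rf3_cases D c₂ α β i' with ⟨g1, gv⟩ | ⟨g1, g2, g3, gv⟩ | ⟨g1, g2, g3, gv⟩ | ⟨g1, g2, gv⟩ | ⟨g1, g2, gv⟩ <;>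
    rw [hv, gv] at hr <;> split_ifs at hl <;> omega

/-- The ends are good: `1 ≤ lf3 < 4 ≤ rf3 < n` for `n = 3 + 1 + (s − t)`, `2 t ≤ s`, and the pairs are distinct. -/
theorem goodEnds_deepThree (s D c₂ c₃ α β : ℕ) (hc2 : c₂ ≤ D) (hαβ : α + β ≤ c₂) (hα : α ≤ c₃)
    (hs : 2 * (D + c₂ + c₃) ≤ s) :
    GoodEnds (3 + 1 + (s - (D + c₂ + c₃))) 4 (D + c₂ + c₃) (lf3 D c₂) (rf3 D c₂ α β) := by
  refine ⟨fun i hi => ?_, fun i hi => ?_, fun i i' hi hi' h1 h2 => ?_⟩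
  · have := lf3_bounds D c₂ i
    omega
  · have := rf3_bounds D c₂ c₃ α β i hαβ hα hi
    omega
  · exact rf3_inj D c₂ c₃ α β i i' hc2 hαβ hα hi hi' h1 h2

/-- **THE LEFT COLLISIONS:** `coll t lf3 = D (D − 1) + c₂ (c₂ − 1) + c₃ (c₃ − 1)`. -/
theorem coll_lf3 (D c₂ c₃ : ℕ) :
    coll (D + (c₂ + c₃)) (lf3 D c₂) = D * (D - 1) + c₂ * (c₂ - 1) + c₃ * (c₃ - 1) := by
  have hcc : coll (D + (c₂ + c₃)) (fun i => if i < D then 1 else if i - D < c₂ then 2 else 3) =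
      coll D (fun _ => 1) + coll (c₂ + c₃) (fun i' => if i' < c₂ then 2 else 3) :=
    coll_concat D (c₂ + c₃) (fun _ => 1) (fun i' => if i' < c₂ then 2 else 3)
      (fun i _ i' _ => by split_ifs <;> omega)
  have hcc2 : coll (c₂ + c₃) (fun i' => if i' < c₂ then 2 else 3) = coll c₂ (fun _ => 2) + coll c₃ (fun _ => 3) :=
    coll_concat c₂ c₃ (fun _ => 2) (fun _ => 3) (fun i _ i' _ => by simp)
  rw [coll_congr (D + (c₂ + c₃)) (lf3 D c₂) (fun i => if i < D then 1 else if i - D < c₂ then 2 else 3)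
    (fun i _ => by unfold lf3; split_ifs <;> omega), hcc, hcc2, coll_const, coll_const, coll_const, add_assoc]

/-- The class of a shared leaf of a full row: three pairs (`p < α`). -/
theorem cls_rf3_full (D c₂ c₃ α β p : ℕ) (hc2 : c₂ ≤ D) (hαβ : α + β ≤ c₂) (hα : α ≤ c₃) (hp : p < α)
    (hD : 1 ≤ D) :
    ((range (D + c₂ + c₃)).filter (fun i => rf3 D c₂ α β i = 4 + p)).card = 3 := by
  have hset : (range (D + c₂ + c₃)).filter (fun i => rf3 D c₂ α β i = 4 + p) = {p, D + p, D + c₂ + p} := by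
    ext i
    simp only [mem_filter, mem_range, mem_insert, mem_singleton]
    constructor
    · rintro ⟨hi, hv⟩
      rcases rf3_cases D c₂ α β i with ⟨h1, hv'⟩ | ⟨h1, h2, h3, hv'⟩ | ⟨h1, h2, h3, hv'⟩ | ⟨h1, h2, hv'⟩ |
          ⟨h1, h2, hv'⟩ <;> rw [hv'] at hv <;> omega
    · rintro (rfl | rfl | rfl)
      · refine ⟨by omega, ?_⟩
        unfold rf3
        rw [if_pos (by omega)]
      · refine ⟨by omega, ?_⟩
        unfold rf3
        rw [if_neg (by omega), if_pos (by omega), if_pos (by omega)]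
        omega
      · refine ⟨by omega, ?_⟩
        unfold rf3
        rw [if_neg (by omega), if_neg (by omega), if_pos (by omega)]
        omega
  rw [hset, card_insert_of_notMem, card_insert_of_notMem, card_singleton]
  · simp only [mem_singleton]
    omega
  · simp only [mem_insert, mem_singleton]
    omega

/-- The class of a shared leaf of a pair row: two pairs (`α ≤ p < α + β`). -/
theorem cls_rf3_pair (D c₂ c₃ α β p : ℕ) (hc2 : c₂ ≤ D) (hαβ : α + β ≤ c₂) (_hα : α ≤ c₃) (hp1 : α ≤ p)
    (hp2 : p < α + β) (hD : 1 ≤ D) :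
    ((range (D + c₂ + c₃)).filter (fun i => rf3 D c₂ α β i = 4 + p)).card = 2 := by
  have hset : (range (D + c₂ + c₃)).filter (fun i => rf3 D c₂ α β i = 4 + p) = {p, D + p} := by
    ext i
    simp only [mem_filter, mem_range, mem_insert, mem_singleton]
    constructor
    · rintro ⟨hi, hv⟩
      rcases rf3_cases D c₂ α β i with ⟨h1, hv'⟩ | ⟨h1, h2, h3, hv'⟩ | ⟨h1, h2, h3, hv'⟩ | ⟨h1, h2, hv'⟩ |
          ⟨h1, h2, hv'⟩ <;> rw [hv'] at hv <;> omega
    · rintro (rfl | rfl)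
      · refine ⟨by omega, ?_⟩
        unfold rf3
        rw [if_pos (by omega)]
      · refine ⟨by omega, ?_⟩
        unfold rf3
        rw [if_neg (by omega), if_pos (by omega), if_pos (by omega)]
        omega
  rw [hset, card_insert_of_notMem, card_singleton]
  simp only [mem_singleton]
  omega

/-- The class of a fresh leaf: at most one pair (`α + β ≤ p`). -/
theorem cls_rf3_fresh (D c₂ c₃ α β p : ℕ) (_hc2 : c₂ ≤ D) (hαβ : α + β ≤ c₂) (_hα : α ≤ c₃) (hp : α + β ≤ p) :
    ((range (D + c₂ + c₃)).filter (fun i => rf3 D c₂ α β i = 4 + p)).card ≤ 1 := by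
  rw [card_le_one]
  intro i hi i' hi'
  rw [mem_filter, mem_range] at hi hi'
  have hv := hi.2
  have hv' := hi'.2
  rcases rf3_cases D c₂ α β i with ⟨h1, hw⟩ | ⟨h1, h2, h3, hw⟩ | ⟨h1, h2, h3, hw⟩ | ⟨h1, h2, hw⟩ | ⟨h1, h2, hw⟩ <;>
    rcases rf3_cases D c₂ α β i' with ⟨g1, gw⟩ | ⟨g1, g2, g3, gw⟩ | ⟨g1, g2, g3, gw⟩ | ⟨g1, g2, gw⟩ |
      ⟨g1, g2, gw⟩ <;> rw [hw] at hv <;> rw [gw] at hv' <;> omega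

/-- **THE RIGHT COLLISIONS:** `coll t rf3 = 6 α + 2 β`. -/
theorem coll_rf3 (D c₂ c₃ α β : ℕ) (hc2 : c₂ ≤ D) (hαβ : α + β ≤ c₂) (hα : α ≤ c₃) (hD : 1 ≤ D) :
    coll (D + c₂ + c₃) (rf3 D c₂ α β) = 6 * α + 2 * β := by
  rw [coll_eq_sum_cls (D + c₂ + c₃) (rf3 D c₂ α β) ((range (D + c₂ + c₃)).image (fun p => 4 + p)) (fun i hi => by
    rw [mem_image]
    have := rf3_bounds D c₂ c₃ α β i hαβ hα hi
    exact ⟨rf3 D c₂ α β i - 4, mem_range.mpr (by omega), by omega⟩)]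
  rw [sum_image (fun p _ p' _ h => by omega)]
  have hval : ∀ p ∈ range (D + c₂ + c₃), cls (D + c₂ + c₃) (rf3 D c₂ α β) (4 + p) *
      (cls (D + c₂ + c₃) (rf3 D c₂ α β) (4 + p) - 1) =
        if p < α then 6 else if p < α + β then 2 else 0 := by
    intro p _
    unfold cls
    split_ifs with h1 h2
    · rw [cls_rf3_full D c₂ c₃ α β p hc2 hαβ hα h1 hD]
    · rw [cls_rf3_pair D c₂ c₃ α β p hc2 hαβ hα (by omega) h2 hD]
    · have := cls_rf3_fresh D c₂ c₃ α β p hc2 hαβ hα (by omega)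
      obtain ⟨k, hk⟩ : ∃ k, ((range (D + c₂ + c₃)).filter (fun i => rf3 D c₂ α β i = 4 + p)).card = k := ⟨_, rfl⟩
      rw [hk] at this ⊢
      interval_cases k <;> rfl
  rw [sum_congr rfl hval]
  have hsplit := sum_range_add_sum_Ico (fun p => if p < α then 6 else if p < α + β then 2 else 0)
    (show α + β ≤ D + c₂ + c₃ by omega)
  rw [← hsplit]
  have hsplit2 := sum_range_add_sum_Ico (fun p => if p < α then 6 else if p < α + β then 2 else 0)
    (show α ≤ α + β by omega)
  rw [← hsplit2]
  have e1 : ∑ p ∈ range α, (if p < α then 6 else if p < α + β then 2 else 0) = 6 * α := by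
    rw [sum_const_nat (m := 6) (fun p hp => if_pos (mem_range.mp hp)), card_range, mul_comm]
  have e2 : ∑ p ∈ Ico α (α + β), (if p < α then 6 else if p < α + β then 2 else 0) = 2 * β := by
    rw [sum_const_nat (m := 2) (fun p hp => by
      rw [mem_Ico] at hp
      rw [if_neg (by omega), if_pos hp.2]), Nat.card_Ico, mul_comm]
    congr 1
    omega
  have e3 : ∑ p ∈ Ico (α + β) (D + c₂ + c₃), (if p < α then 6 else if p < α + β then 2 else 0) = 0 := by
    apply sum_eq_zero
    intro p hp
    rw [mem_Ico] at hp
    rw [if_neg (by omega), if_neg (by omega)]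
  rw [e1, e2, e3, add_zero]

/-- Every class of `rf3` has at most three pairs (every leaf carries at most three off-edges). -/
theorem cls_rf3_le_three (D c₂ c₃ α β y : ℕ) (hc2 : c₂ ≤ D) (hαβ : α + β ≤ c₂) (hα : α ≤ c₃) (hD : 1 ≤ D) :
    ((range (D + c₂ + c₃)).filter (fun i => rf3 D c₂ α β i = y)).card ≤ 3 := by
  by_cases hy : 4 ≤ y ∧ y < 4 + (D + c₂ + c₃)
  · obtain ⟨p, rfl⟩ : ∃ p, y = 4 + p := ⟨y - 4, by omega⟩
    by_cases h1 : p < α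
    · have := cls_rf3_full D c₂ c₃ α β p hc2 hαβ hα h1 hD
      omega
    · by_cases h2 : p < α + β
      · have := cls_rf3_pair D c₂ c₃ α β p hc2 hαβ hα (by omega) h2 hD
        omega
      · have := cls_rf3_fresh D c₂ c₃ α β p hc2 hαβ hα (by omega)
        omega
  · rw [card_eq_zero.mpr (filter_eq_empty_iff.mpr (fun i hi hv => by
      rw [mem_range] at hi
      have := rf3_bounds D c₂ c₃ α β i hαβ hα hi
      omega))]
    omega

/-- The classes of `lf3`: `D` at `1`, `c₂` at `2`, `c₃` at `3`, none elsewhere. -/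
theorem cls_lf3 (D c₂ c₃ v : ℕ) :
    ((range (D + c₂ + c₃)).filter (fun i => lf3 D c₂ i = v)).card =
      if v = 1 then D else if v = 2 then c₂ else if v = 3 then c₃ else 0 := by
  split_ifs with h1 h2 h3
  · subst h1
    have : (range (D + c₂ + c₃)).filter (fun i => lf3 D c₂ i = 1) = range D := by
      ext i
      simp only [mem_filter, mem_range]
      unfold lf3
      constructor
      · rintro ⟨hi, hv⟩
        split_ifs at hv <;> omega
      · intro hi
        exact ⟨by omega, if_pos hi⟩
    rw [this, card_range]
  · subst h2
    have : (range (D + c₂ + c₃)).filter (fun i => lf3 D c₂ i = 2) = Ico D (D + c₂) := by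
      ext i
      simp only [mem_filter, mem_range, mem_Ico]
      unfold lf3
      constructor
      · rintro ⟨hi, hv⟩
        split_ifs at hv <;> omega
      · intro hi
        refine ⟨by omega, ?_⟩
        rw [if_neg (by omega), if_pos (by omega)]
    rw [this, Nat.card_Ico]
    omega
  · subst h3
    have : (range (D + c₂ + c₃)).filter (fun i => lf3 D c₂ i = 3) = Ico (D + c₂) (D + c₂ + c₃) := by
      ext i
      simp only [mem_filter, mem_range, mem_Ico]
      unfold lf3
      constructor
      · rintro ⟨hi, hv⟩
        split_ifs at hv <;> omega
      · intro hi
        refine ⟨by omega, ?_⟩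
        rw [if_neg (by omega), if_neg (by omega)]
    rw [this, Nat.card_Ico]
    omega
  · rw [card_eq_zero, filter_eq_empty_iff]
    intro i _ hv
    have := lf3_bounds D c₂ i
    omega

/-- **THE DEEP WITNESS ON `4 + (s − t)` VERTICES:** for `3 ≤ D`, `c₃ ≤ c₂ ≤ D`, `t = D + c₂ + c₃`, `α ≤ c₃`,
`α + β ≤ c₂`, `2 t ≤ s`, a triangle-free graph with `s` edges, a vertex `w` of degree `s − t`, every off-degree
`≤ D`, a non-neighbour of off-degree `D`, and the band value
`2 j = t (t − 1) − (D (D − 1) + c₂ (c₂ − 1) + c₃ (c₃ − 1) + 6 α + 2 β)`. -/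
theorem deepThreeWitness (s t D c₂ c₃ α β : ℕ) (hD : 3 ≤ D) (hc2 : c₂ ≤ D) (hc3 : c₃ ≤ c₂)
    (ht : D + c₂ + c₃ = t) (hα : α ≤ c₃) (hαβ : α + β ≤ c₂) (hs : 2 * t ≤ s) :
    ∃ (H : SimpleGraph (Fin (3 + 1 + (s - t)))) (_ : DecidableRel H.Adj), H.CliqueFree 3 ∧
      H.edgeFinset.card = s ∧ ∃ w, deg H w + t = s ∧ (∀ v, offDeg H w v ≤ D) ∧
        (∃ x, ¬ H.Adj w x ∧ offDeg H w x = D) ∧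
        ∑ v, deg H v * deg H v + 2 * (t * (s - t - 1)) +
          (t * (t - 1) - (D * (D - 1) + c₂ * (c₂ - 1) + c₃ * (c₃ - 1) + 6 * α + 2 * β)) = s * (s + 1) := by
  subst ht
  set t := D + c₂ + c₃ with htdef
  set n := 3 + 1 + (s - t) with hn
  have hn0 : 0 < n := by omega
  have hg := goodEnds_deepThree s D c₂ c₃ α β hc2 hαβ hα hs
  have hval := genWitness_missing_value n 4 s t hn0 (lf3 D c₂) (rf3 D c₂ α β) hg (by omega) (by omega) (by omega)
    (by omega)
  have hatt : ((range t).filter (fun i => rf3 D c₂ α β i < 4 + (s - t))).card = t := by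
    rw [filter_true_of_mem (fun i hi => by
      rw [mem_range] at hi
      have := rf3_bounds D c₂ c₃ α β i hαβ hα hi
      omega), card_range]
  have hcl : coll t (lf3 D c₂) = D * (D - 1) + c₂ * (c₂ - 1) + c₃ * (c₃ - 1) := by
    rw [htdef, add_assoc]
    exact coll_lf3 D c₂ c₃
  rw [hatt, hcl, coll_rf3 D c₂ c₃ α β hc2 hαβ hα (by omega), Nat.sub_self, mul_zero, zero_add] at hval
  refine ⟨_, inferInstance, cliqueFree_of_bipSub _ _ (bipSub_missingGraph _ _),
    card_edges_missingGraph_genWitness n 4 s t hn0 (lf3 D c₂) (rf3 D c₂ α β) hg (by omega) (by omega) (by omega),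
    fin' n hn0 0, ?_, ?_, ?_, ?_⟩
  · rw [deg_missingGraph_genWitness_zero n 4 s t hn0 (lf3 D c₂) (rf3 D c₂ α β) hg (by omega) (by omega)]
    omega
  · intro v
    have hv : v = fin' n hn0 v.val := Fin.ext (by rw [fin'_val n hn0 v.val v.isLt])
    rw [hv]
    by_cases hva : v.val < 4
    · rw [offDeg_genWitness_left n 4 s t hn0 (lf3 D c₂) (rf3 D c₂ α β) hg (by omega) v.val hva, cls_lf3]
      split_ifs <;> omega
    · rw [offDeg_genWitness_right n 4 s t hn0 (lf3 D c₂) (rf3 D c₂ α β) hg (by omega) v.val (by omega) v.isLt]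
      have := cls_rf3_le_three D c₂ c₃ α β v.val hc2 hαβ hα (by omega)
      rw [← htdef] at this
      omega
  · refine ⟨fin' n hn0 1, not_adj_genWitness_one n 4 s t hn0 (lf3 D c₂) (rf3 D c₂ α β) (by omega) (by omega), ?_⟩
    rw [offDeg_genWitness_left n 4 s t hn0 (lf3 D c₂) (rf3 D c₂ α β) hg (by omega) 1 (by omega), cls_lf3]
    simp
  · have e : t * (t - 1) - (D * (D - 1) + c₂ * (c₂ - 1) + c₃ * (c₃ - 1) + (6 * α + 2 * β)) =
        t * (t - 1) - (D * (D - 1) + c₂ * (c₂ - 1) + c₃ * (c₃ - 1) + 6 * α + 2 * β) := by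
      omega
    rw [e] at hval
    exact hval

end C047

end TriangleCap

end PercRepro
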